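import Summits.QuantumAdvantage.QuantumAdvantage.Theses.CompactnessLift
import Summits.QuantumAdvantage.QuantumAdvantage.Theorems.CompactnessPrinciple.Negative.StubFuelledClockFalse
import Literature.Computability.Complexity.RelativizedTime
import Literature.Computability.Complexity.PaulPippengerSzemerediTrotter1983Blocks
import Literature.Computability.Complexity.UnaryArithMachines
import Literature.Computability.QuantumComplexity.BQTime

/-!
# Disproof of `CompactnessPrinciple` — standing disprover, cycle 1 (refuter-cdisprove-stmt-QuantumAdvantage-15270-0, 2026-08-17)

EXTENDS the vetting seat's file below (kept verbatim). New content, all sorry-free, indexed: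

* `-- Tightness / small models` (§T, LANDED: `Theorems/CompactnessPrinciple/Negative/SliceZeroEmpty.lean`
  p159347 ACCEPTED; made UNCONDITIONAL by `Negative/ExponentTight.lean` p160157 — `quadQ_nonempty` /
  `BQTime_sq_nonempty`: the gate-free Clifford+T family is an `O(n²)`-uniform decider of `{x | x₀ = 1}`,
  the first kernel-checked inhabitant of `QuadQ = BQTime(n²)`; hence `not_quadQ_subset_bp_DTIME_pow_zero`,
  `exponent_pos : QuadQ ⊆ bp (DTIME n^c) → 1 ≤ c` with no hypothesis, `languageLadder_rung_zero`):
  the slice `c = 0` of the typed family is EMPTY — `bp_DTIME_pow_zero_eq_empty : bp (DTIME (· ^ 0)) = ∅`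
  (engine: the input-consumption bound `length_input_le_of_outputsWithin`, `|l| ≤ |l'| + Q m`, from
  `TM2Comp.length_step_ge`; `timeClass_const_eq_empty`, `DTIME_pow_zero_eq_empty`). With the seat's
  `bp_DTIME_pow_eq_BPP` the typed family takes exactly TWO values: `bp_DTIME_pow_eq_ite :
  H1 → bp (DTIME (· ^ c)) = if c = 0 then ∅ else BPP`. Readings: the crux's `∃ c` is witnessed only by
  `c ≥ 1` once `QuadQ ≠ ∅` (`exponent_pos_of_quadQ_subset`), and the sibling crux reads EXACTLY
  `languageLadder_iff_of_H1 : H1 → (LanguageLadder ↔ ¬ QuadQ ⊆ BPP)` (the summit restricted to `QuadQ`;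
  strengthens the seat's one-directional `languageLadder_imp_summit_of_H1`).
* `-- Line coin-padding-slices` (§L1, registered 09:53Z, NOT picked): its stub `stub_fuelledClock` is
  FALSE as stated — landed by refuter-skel-…-vet-0 (`Negative/StubFuelledClockFalse.lean`, p154598,
  imported here: `Negative.stub_fuelledClock_false`, witness `(p, B) = (X², 0)`). Added here: the general
  criterion `clock_not_linearTime` (`p ∉ O(B + X)` kills linear time) and `stub_fuelledClock_false_of_guard`
  (for EVERY guard `B` some `p` kills it ⇒ the repair must relate `p` to `B`: `∀ n, p n ≤ B n`), LANDED as
  `Negative/StubFuelledClockGuard.lean` (p159386 ACCEPTED).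
* `-- Targets: line universal-clock-padding` (§L2, PICKED 11:39Z by prover-line-…-15270-0; stubs
  `stub_squareClock`, `stub_instMap`, `stub_truncRun`, `stub_preimage`): cheap attacks FAIL on all four
  (verdicts and the checks run are in the section docstrings): output-length (`OutputsWithin.length_le`) and
  input-consumption (`length_input_le_of_outputsWithin`) sanity pass (`instMap_output_length`,
  `truncRun_consistent_with_reading`), `stub_preimage` is vacuous at `d = 0` (`DTIME_pow_zero_eq_empty`) and
  is `TimeComputable.comp_holds` bookkeeping at `d ≥ 1`, `stub_truncRun` matches the tree's
  `outputsWithin_truncMapAux_boolPair` (short `z` included: `z.take _ = z`), `stub_squareClock` is the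
  `|inst|²`-clocked twin of the PROVED `ClockedUA` completeness/soundness. 4 targets, 0 broken.
* `-- Intended crux CP′` (§I): `CP'`, `Ladder'` (the restated forms of cstrat r1 §6 / Repair.lean),
  `summit_imp_cp'`, `cp'_iff_glue'` (`CP′ ↔ (Ladder′ → S)`), and the IRREFUTABILITY facts
  `not_cp'_imp_collapse : ¬ CP′ → BQP ⊆ BPP`, `not_cp'_imp_not_summit : ¬ CP′ → ¬ QuantumAdvantage`,
  `not_compactnessPrinciple_imp_not_summit` (same for the typed crux): an unconditional Lean refutation of
  either form of the crux IS a disproof of the summit. The only negative avenue is relativised —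
  `OracleDichotomyPos` (def; = proposed signature of item 15277, idea `levelled-trap-oracle`): an oracle
  world with `BQP^A ⊆ BPP^A` and unbounded classical overhead over `BQTime^A(n²)`; open, needs an oracle
  CONSTRUCTION (FFKL base + levelled Forrelation traps), not attempted in Lean this cycle.

WHY IT RESISTS (for the provers): as typed, CP is a THEOREM modulo clocked simulation (the picked line is
closing it); as intended (CP′), `¬CP′ ⊢ BQP ⊆ BPP ∧ ¬S`, so no unconditional kill exists unless the
summit is false, and the census (STRATEGY-CENSUS r1/b1, NEGATIVE-NOTES-ideator2) finds no implausible
consequence of `¬CP′` either (it is implied by the disbelieved-but-consistent `BQP ⊆ BPP ∧ Ladder′`).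
-/

/-!
# Disproof of `CompactnessPrinciple` — findings: NOT refutable; TRUE as typed (coin padding) ⇒ MISSTATED

Adversary-side work file for the crux `CompactnessLift.CompactnessPrinciple` (stmt-QuantumAdvantage-15270),
opened by the crux-attack vetting seat refuter-rattack-stmt-QuantumAdvantage-15270-0 (2026-08-17). A later
`cdisprove` seat EXTENDS this file. Index of findings:

* `BPTime_pow_subset_bp_DTIME_pow` (unconditional) — every honest `BPTIME(n^k)` lies in the slice `c = 1`
  of the route's class `bp (DTIME (·^c))`; the time index is void;
* `compactnessPrinciple_of_nonuniform` (unconditional) — the NON-uniform statement already gives the crux;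
* `compactnessPrinciple_of_H1`, `bp_DTIME_pow_eq_BPP`, `languageLadder_imp_summit_of_H1` — modulo the
  textbook identity `H1 : BPP ⊆ ⋃ₖ BPTIME(n^k)` the crux is a theorem and the sibling crux is the summit;
* `summit_imp_compactnessPrinciple`, `compactnessPrinciple_iff_glue` (unconditional logic);
* no `¬ CompactnessPrinciple` can exist short of proving `BQP ⊆ BPP`; no `_false_without_` analysis applies
  (the statement has one hypothesis, `BQP ⊆ BPP`, and dropping it leaves `UC`, refuted only by the summit).
* Repair: `BPTime (fun n => n ^ c)` for `bp (DTIME (fun n => n ^ c))` (see the seat's Repair.lean on the item).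

**Finding (misstated, not refutable).** The route types "BP·DTIME(n^c)" as
`bp (DTIME (fun n => n ^ c))`. In the tree's operator `bp C` (ProbabilisticClasses.lean) the coin
string `y` has length `p |x|` for an ARBITRARY polynomial `p`, and the inner language `L' ∈ DTIME t`
is clocked on the padded input `boolPair x y` of length `2|x| + 2 + p |x|` (Classes.lean,
BoolEncodings.lean). Coins are therefore free padding, and the time index `c` of
`bp (DTIME (fun n => n ^ c))` carries no information once `c ≥ 1`:

* `BPTime (fun n => n ^ k) ⊆ bp (DTIME fun n => n)` for EVERY `k` is already a tree theorem
  (`bpTime_pow_subset_bp`, RelativizedTime.lean): the honest class BPTIME(n^k) (coins AND time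
  `O(n^k)` in `|x|`) sits inside the slice `c = 1`.
* Hence, modulo the textbook identity `BPP = ⋃ₖ BPTIME(n^k)` (Arora–Barak 2009, Def. 7.2; its `⊇`
  half is the tree theorem `iUnion_BPTime_pow_subset_BPP`, its `⊆` half `H1` below is a routine
  clocked-simulation machine construction recorded as "not here … none is requested" in the design
  notes of RelativizedTime.lean), `bp (DTIME fun n => n ^ c) = BPP` for all `c ≥ 1`
  (`bp_DTIME_pow_eq_BPP`), and

  - `CompactnessPrinciple` follows from `H1` alone (`compactnessPrinciple_of_H1`): zero quantum
    content, true in every relativised world, NOT the intended "uniform dequantisation exponent";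
  - `LanguageLadder → QuantumAdvantage` directly (`languageLadder_imp_summit_of_H1`): the rank-3
    crux is the summit in a costume (its converse is the support `SummitGivesLadder`);
  - unconditionally, `QuantumAdvantage → CompactnessPrinciple` and
    `CompactnessPrinciple ↔ (LanguageLadder → QuantumAdvantage)` (pure logic): CP is exactly the
    glue of the assembly.

**Why `H1` holds in the tree's TM2 model (paper).** Let `L ∈ BPP = bp P` via `L'' ∈ DTIME(n^{k''})`
(machine `M''`, time `c'' N^{k''} + c''`) and coin polynomial `p`. Put
`T(n) := c'' (2n + 2 + p n)^{k''} + c''` and take the coin budget `c n^k + c ≥ T(n)`. The inner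
machine, on input `w`, (i) splits `w = boolPair x r` (pairs `bb` until `01`; linear), (ii) computes
`p |x|` and `T |x|` in unary by nested counters, each increment clocked against one symbol of `r`
(abort-and-reject if `r` is exhausted first; linear in `|w|`), (iii) copies `boolPair x (r.take (p |x|))`
onto `M''`'s input stack (two linear passes) and runs `M''` natively (`≤ T |x| ≤ |r| ≤ |w|` steps,
guaranteed by (ii)), (iv) empties the auxiliary stacks and outputs `M''`'s bit (linear; `haltList`
form). Total `O(|w|)` on every input, and on coin strings of the prescribed length the verdict is
`M''(boolPair x r↾p|x|)`, whose success probability is that of `L''` on uniform `p |x|`-bit coins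
(marginal of a uniform string), `≥ 2/3`. So `L ∈ bpTime (· ^ k) (DTIME id) = BPTime (· ^ k)`.

**Repair (planner).** Replace `Literature.Computability.Complexity.bp (Literature.Computability.Complexity.DTIME (fun n => n ^ c))`
by `Literature.Computability.Complexity.BPTime (fun n => n ^ c)` in CompactnessPrinciple,
LanguageLadder, PlImpliesCp and SummitGivesLadder (the assembly proof is unchanged; `S → ¬UC'`
still holds via `BPTime_pow_subset_BPP`). The repaired CP′,
`BQP ⊆ BPP → ∃ c, QuadQ ⊆ BPTime (fun n => n ^ c)`, is the intended uniform-exponent principle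
and is NOT hit by this artefact (BPTime(n^c) grows with `c`: coins and time are both `O(|x|^c)`).
-/

set_option linter.dupNamespace false

namespace Summit.QuantumAdvantage.QuantumAdvantage.Cruxes.CompactnessPrinciple.Disproof

open Literature.Computability.Complexity Literature.Computability.Cryptography
open Summit.QuantumAdvantage.QuantumAdvantage.Theses.CompactnessLift

/-- `QuadQ`: the route's inlined comprehension (verbatim) — languages decided with error `≤ 1/3`
by oracle-free Clifford+T families whose sigma-encoding is computable in time `C n² + C` from `1ⁿ`. -/
def QuadQ : Set (Language Bool) :=
  {L : Language Bool | ∃ F : QCircuitFamily cliffordT, F.IsOracleFree ∧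
    (∃ C : ℕ, TimeComputable Computability.unaryEncodeNat (QCircuit.sigmaEncode (G := cliffordT))
      (fun n => (⟨n, F.ancillas n, F.circ n⟩ : Σ n m : ℕ, QCircuit cliffordT (n + m)))
      (fun n => C * n ^ 2 + C)) ∧
    ∀ x, (x ∈ L → 2 / 3 ≤ F.acceptProbOn 0 x) ∧ (x ∉ L → F.acceptProbOn 0 x ≤ 1 / 3)}

/-- The crux, read back through `QuadQ` (definitional). -/
theorem compactnessPrinciple_iff :
    CompactnessPrinciple ↔ (BQP ⊆ BPP → ∃ c : ℕ, QuadQ ⊆ bp (DTIME fun n => n ^ c)) :=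
  Iff.rfl

/-- The sibling crux, read back through `QuadQ` (definitional). -/
theorem languageLadder_iff :
    LanguageLadder ↔ ∀ c : ℕ, ∃ L ∈ QuadQ, L ∉ bp (DTIME fun n => n ^ c) :=
  Iff.rfl

/-- Support item `QuadSubsetBQP` (stmt-15275), proved for self-containedness (an `O(n²)` encoder
time bound is the polynomial `C C * X ^ 2 + C C`). Not landed by the refuter (positive item). -/
theorem quadQ_subset_BQP : QuadQ ⊆ BQP := by
  rintro L ⟨F, hfree, ⟨C, hT⟩, hgap⟩
  rw [ClassBQP.mem_BQP_iff]
  refine ⟨F, hfree, ⟨Polynomial.C C * Polynomial.X ^ 2 + Polynomial.C C, ?_⟩, hgap⟩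
  exact hT.mono fun n => le_of_eq (by simp)

/-- The route item `QuadSubsetBQP` itself (same proof through the definitional unfolding). -/
theorem quadSubsetBQP_holds : QuadSubsetBQP := quadQ_subset_BQP

/-- `H1`: the `⊆` half of the textbook identity `BPP = ⋃ₖ BPTIME(n^k)` (Arora–Barak 2009, Def. 7.2:
"BPP = ⋃_c BPTIME(n^c)"); the `⊇` half is the tree theorem `iUnion_BPTime_pow_subset_BPP`. A routine
clocked-simulation TM2 construction (module docstring), not yet in the tree. -/
def BPPSubsetUnionBPTime : Prop :=
  BPP ⊆ ⋃ k : ℕ, BPTime fun n => n ^ k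

/-- Easy half of the collapse (unconditional): `bp (DTIME n^c) ⊆ BPP`. -/
theorem bp_DTIME_pow_subset_BPP (c : ℕ) : bp (DTIME fun n => n ^ c) ⊆ BPP :=
  (bp_mono fun _ hL => Set.mem_iUnion.2 ⟨c, hL⟩ : bp (DTIME fun n => n ^ c) ⊆ bp Classes.P)

/-- **Coins are free padding (unconditional)**: for EVERY `k`, the honest class `BPTIME(n^k)`
(coins and time `O(|x|^k)`) already lies in the slice `c = 1` of the route's class, hence in every
slice `c ≥ 1` — the time index of `bp (DTIME n^c)` cannot see the exponent `k` at all
(tree theorem `bpTime_pow_subset_bp` + monotonicity). -/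
theorem BPTime_pow_subset_bp_DTIME_pow (k : ℕ) {c : ℕ} (hc : 1 ≤ c) :
    BPTime (fun n => n ^ k) ⊆ bp (DTIME fun n => n ^ c) := by
  intro L hk
  have h₁ : L ∈ bp (DTIME fun n => n) := bpTime_pow_subset_bp (DTIME fun n => n) k hk
  exact bp_mono (DTIME_mono fun n => Nat.le_self_pow (by omega) n) h₁

/-- Under `H1`, `BPP ⊆ bp (DTIME n^c)` for every `c ≥ 1`. -/
theorem BPP_subset_bp_DTIME_pow (h : BPPSubsetUnionBPTime) {c : ℕ} (hc : 1 ≤ c) :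
    BPP ⊆ bp (DTIME fun n => n ^ c) := by
  intro L hL
  obtain ⟨k, hk⟩ := Set.mem_iUnion.1 (h hL)
  exact BPTime_pow_subset_bp_DTIME_pow k hc hk

/-- **What the typing loses, isolated (unconditional)**: the NON-uniform statement "if `BQP ⊆ BPP`
then every `QuadQ` language lies in SOME honest `BPTIME(n^k)`" — which has no uniform exponent in
it and is just `BQP ⊆ BPP` plus the textbook identity `BPP = ⋃ₖ BPTIME(n^k)` — already implies the
crux as typed. `bp (DTIME n^c)` cannot distinguish "one exponent for all of QuadQ" from "each
language has its own exponent". -/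
theorem compactnessPrinciple_of_nonuniform
    (h : BQP ⊆ BPP → QuadQ ⊆ ⋃ k : ℕ, BPTime fun n => n ^ k) : CompactnessPrinciple := by
  intro hsub
  refine ⟨1, fun L hL => ?_⟩
  obtain ⟨k, hk⟩ := Set.mem_iUnion.1 (h hsub hL)
  exact BPTime_pow_subset_bp_DTIME_pow k le_rfl hk

/-- Under `H1` the time index of `bp (DTIME n^c)` is void: the class is `BPP` for every `c ≥ 1`. -/
theorem bp_DTIME_pow_eq_BPP (h : BPPSubsetUnionBPTime) {c : ℕ} (hc : 1 ≤ c) :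
    bp (DTIME fun n => n ^ c) = BPP :=
  Set.Subset.antisymm (bp_DTIME_pow_subset_BPP c) (BPP_subset_bp_DTIME_pow h hc)

/-- **The crux is a padding artefact**: `H1 → CompactnessPrinciple` (take `c = 1`; no quantum
content, relativises). -/
theorem compactnessPrinciple_of_H1 (h : BPPSubsetUnionBPTime) : CompactnessPrinciple := by
  intro hsub
  exact ⟨1, fun L hL => BPP_subset_bp_DTIME_pow h le_rfl (hsub (quadQ_subset_BQP hL))⟩

/-- Consequently the support `PlImpliesCp` is also void under `H1` (its conclusion is CP). -/
theorem plImpliesCp_of_H1 (h : BPPSubsetUnionBPTime) : PlImpliesCp :=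
  fun _ => compactnessPrinciple_of_H1 h

/-- **The sibling crux is the summit in a costume**: under `H1`, `LanguageLadder → QuantumAdvantage`
without CP (level `c = 1` of the ladder is `QuadQ ⊄ BPP`). -/
theorem languageLadder_imp_summit_of_H1 (h : BPPSubsetUnionBPTime) :
    LanguageLadder → _root_.QuantumAdvantage := by
  intro hLL
  obtain ⟨L, hL, hnot⟩ := hLL 1
  exact ⟨L, quadQ_subset_BQP hL, fun hB => hnot (BPP_subset_bp_DTIME_pow h le_rfl hB)⟩

/-- Unconditionally, the summit implies CP (vacuously: `S` negates the premise `BQP ⊆ BPP`). -/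
theorem summit_imp_compactnessPrinciple : _root_.QuantumAdvantage → CompactnessPrinciple := by
  rintro ⟨L, hL, hLB⟩ hsub
  exact absurd (hsub hL) hLB

/-- Unconditionally, CP is exactly the glue `LanguageLadder → S` (pure logic). -/
theorem compactnessPrinciple_iff_glue :
    CompactnessPrinciple ↔ (LanguageLadder → _root_.QuantumAdvantage) := by
  constructor
  · exact fun hCP hLL => closes hCP hLL
  · intro hglue hsub
    by_contra hno
    have hLL : LanguageLadder := fun c => by
      by_contra h'
      exact hno ⟨c, fun L hL => by_contra fun hx => h' ⟨L, hL, hx⟩⟩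
    obtain ⟨L, hL, hLB⟩ := hglue hLL
    exact hLB (hsub hL)


/-! ## Cycle 1 additions (standing disprover refuter-cdisprove-stmt-QuantumAdvantage-15270-0, 2026-08-17) -/

section Tightness
/-! ### Tightness / small models: the slice `c = 0` is empty (landed: `Negative/SliceZeroEmpty.lean`) -/

open Turing Function Literature.Computability.Complexity.TM2Comp

/-- Induction along an `n`-step run for a quantity that SHRINKS by at most `D` per step (twin of
`TM2Comp.iterate_bind_le`). -/
theorem iterate_bind_ge {σ : Type*} (f : σ → Option σ) (φ : σ → ℕ) (D : ℕ)
    (H : ∀ c d, f c = some d → φ c ≤ φ d + D) (n : ℕ) :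
    ∀ c d, (flip bind f)^[n] (some c) = some d → φ c ≤ φ d + D * n := by
  induction n with
  | zero =>
    intro c d h
    simp only [iterate_zero, id_eq, Option.some.injEq] at h
    simp [h]
  | succ n ih =>
    intro c d h
    rw [iterate_bind_succ] at h
    cases hfc : f c with
    | none => rw [hfc, iterate_bind_none] at h; cases h
    | some c' =>
      rw [hfc] at h
      have h1 := H c c' hfc
      have h2 := ih c' d h
      rw [Nat.mul_succ]
      omega

/-- **Input-consumption bound** (twin of `OutputsWithin.length_le`): `|l| ≤ |l'| + Q · m`,
`Q = machinePopBound` — a halting run pops its whole input (`haltList` carries only the output) at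
`≤ Q` symbols per step (`TM2Comp.length_step_ge`). -/
theorem length_input_le_of_outputsWithin {Γ₀ Γ₁ : Type} (M : TM2ComputableAux Γ₀ Γ₁)
    {l : List Γ₀} {l' : List Γ₁} {m : ℕ} (h : M.OutputsWithin l l' m) :
    l.length ≤ l'.length + machinePopBound M.tm * m := by
  obtain ⟨⟨⟨n, hn⟩, hnm⟩⟩ := h
  have H := iterate_bind_ge M.tm.step (fun c => (c.stk M.tm.k₀).length) (machinePopBound M.tm)
    (fun c d hcd => length_step_ge M.tm c d hcd M.tm.k₀) n _ _ hn
  rw [haltList_eq, initList_eq] at H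
  simp only [update_self, List.length_map] at H
  have H' := length_update_bot_le (Γ := M.tm.Γ) M.tm.k₁ M.tm.k₀ (l'.map M.outputAlphabet.symm)
  rw [List.length_map] at H'
  change n ≤ m at hnm
  calc l.length ≤ _ + machinePopBound M.tm * n := H
    _ ≤ l'.length + machinePopBound M.tm * m :=
        Nat.add_le_add H' (Nat.mul_le_mul_left _ hnm)

/-- **Constant-time classes are empty** (the halting-rule convention of `TimeBounds.lean` as a
theorem): the input `1^{Q c + 2}` cannot be consumed in `c` steps. -/
theorem timeClass_const_eq_empty (c : ℕ) : TimeClass (fun _ => c) = ∅ := by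
  ext L
  simp only [Set.mem_empty_iff_false, iff_false]
  rintro ⟨M, hM⟩
  have h := length_input_le_of_outputsWithin M (hM (List.replicate (machinePopBound M.tm * c + 2) true))
  simp [Computability.encodeBool] at h
  omega

/-- `DTIME (fun n => n ^ 0) = DTIME 1 = ∅`. (So stub `stub_preimage` of the picked line is vacuous at
`d = 0`.) -/
theorem DTIME_pow_zero_eq_empty : DTIME (fun n => n ^ 0) = ∅ := by
  refine Set.eq_empty_of_subset_empty fun L hL => ?_
  obtain ⟨c, hc⟩ := hL
  have : TimeClass (fun n : ℕ => c * n ^ 0 + c) = ∅ := by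
    rw [show (fun n : ℕ => c * n ^ 0 + c) = fun _ => c * 1 + c from funext fun n => by simp]
    exact timeClass_const_eq_empty _
  rw [this] at hc
  exact hc

/-- **The slice `c = 0` of the crux's family is empty.** -/
theorem bp_DTIME_pow_zero_eq_empty : bp (DTIME fun n => n ^ 0) = ∅ := by
  rw [DTIME_pow_zero_eq_empty]; ext L; simp [bp]

/-- **The typed family has exactly two values** (under `H1`): `∅` at `c = 0`, `BPP` at `c ≥ 1`. -/
theorem bp_DTIME_pow_eq_ite (h : BPPSubsetUnionBPTime) (c : ℕ) :
    bp (DTIME fun n => n ^ c) = if c = 0 then ∅ else BPP := by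
  split_ifs with hc
  · subst hc; exact bp_DTIME_pow_zero_eq_empty
  · exact bp_DTIME_pow_eq_BPP h (Nat.one_le_iff_ne_zero.2 hc)

/-- `QuadQ` lies in the slice `c = 0` iff it is empty. -/
theorem quadQ_subset_slice_zero_iff : QuadQ ⊆ bp (DTIME fun n => n ^ 0) ↔ QuadQ = ∅ := by
  rw [bp_DTIME_pow_zero_eq_empty, Set.subset_empty_iff]

/-- **Tightness of the exponent**: once `QuadQ ≠ ∅`, any witness `c` of the crux's conclusion has
`1 ≤ c` (and `c = 1` is attained under `BQP ⊆ BPP` + `H1`, `compactnessPrinciple_of_H1`). -/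
theorem exponent_pos_of_quadQ_subset (hne : QuadQ.Nonempty) {c : ℕ}
    (hc : QuadQ ⊆ bp (DTIME fun n => n ^ c)) : 1 ≤ c := by
  rcases Nat.eq_zero_or_pos c with rfl | h
  · exact absurd (quadQ_subset_slice_zero_iff.1 hc) hne.ne_empty
  · exact h

/-! NOTE. The hypothesis `QuadQ.Nonempty` of `exponent_pos_of_quadQ_subset` is DISCHARGED in the tree by
`Summit.QuantumAdvantage.QuantumAdvantage.Theorems.CompactnessPrinciple.Negative.quadQ_nonempty`
(`Negative/ExponentTight.lean`, p160157; not imported here until it is applied): the gate-free family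
`⟨fun _ => 0, fun _ => ⟨[]⟩⟩ : QCircuitFamily cliffordT` decides `{x | 2/3 ≤ Pr[accept x]} = {x | x₀ = 1}`
with probabilities in `{0, 1}` and has an `O(n)`-time description `1ⁿ ↦ ⟨bin n, 01⟩`
(`timeComputable_unary_id` ⨟ `dup` ⨟ `rePair` ⨟ a separator-expanding `FST`). So `exponent_pos` and
`languageLadder_rung_zero` hold with no hypothesis, and `BQTime (· ^ 2) ≠ ∅` (non-vacuity of the
repaired route's class). -/

/-- **Exact reading of the sibling crux under `H1`**: `LanguageLadder ↔ ¬ QuadQ ⊆ BPP` — rung `0`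
says `QuadQ ≠ ∅` (slice `0` is empty), every rung `c ≥ 1` says `QuadQ ⊄ BPP` (slice `c` is `BPP`),
and `QuadQ ⊄ BPP` already gives `QuadQ ≠ ∅`. So the typed ladder is the summit restricted to `QuadQ`
(both directions; the seat's `languageLadder_imp_summit_of_H1` was `→` only). -/
theorem languageLadder_iff_of_H1 (h : BPPSubsetUnionBPTime) : LanguageLadder ↔ ¬ QuadQ ⊆ BPP := by
  rw [languageLadder_iff]
  constructor
  · intro hLL hsub
    obtain ⟨L, hL, hnot⟩ := hLL 1
    exact hnot (BPP_subset_bp_DTIME_pow h le_rfl (hsub hL))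
  · intro hnot c
    rcases Nat.eq_zero_or_pos c with rfl | hc
    · rw [bp_DTIME_pow_zero_eq_empty]
      by_contra hall
      push Not at hall
      exact hnot fun L hL => absurd (hall L hL) (Set.notMem_empty L)
    · by_contra hall
      push Not at hall
      exact hnot fun L hL => bp_DTIME_pow_subset_BPP c (hall L hL)

end Tightness

section LineCoinPaddingSlices
/-! ### Line `coin-padding-slices` (registered, NOT picked): `stub_fuelledClock` is false as stated

Landed: `Negative/StubFuelledClockFalse.lean` (vet seat, p154598; imported) — `Negative.stub_fuelledClock_false`,
witness `(p, B) = (X², 0)`, repair `∀ n, p.eval n ≤ B.eval n`. Added by this seat (proposed as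
`Negative/StubFuelledClockGuard.lean`): the general criterion and "no guard alone repairs it". The second
stub `stub_headerTake` passes the output-length check (`|takeFn v| ≤ |v| + 2` by `splitOnes_le`,
`length_boolUnpair_parts_le`) and is a routine `RePairTM`-shaped machine: not attacked further. -/

open Polynomial
open Literature.Computability.Complexity.TM2Comp (machinePushBound)

/-- The landed kill, re-exported by name (type: `¬ ∀ p B, ∃ a, TimeComputable id id (clockFn p B) (a·n+a)`
with `clockFn` unfolded). -/
example := @Summit.QuantumAdvantage.QuantumAdvantage.Theorems.CompactnessPrinciple.Negative.stub_fuelledClock_false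

/-- **General criterion**: any `f` agreeing with the fuel-guarded clock on guard-passing pairs is not
linear time as soon as `p ∉ O(B + X)` (`∀ κ, ∃ n, κ (B n + n + 1) < p n`): input `⟨1ⁿ, 1^{B n}⟩`,
output `p n + 1 + |w|` symbols against `|w| + D (a |w| + a)` (`OutputsWithin.length_le`). -/
theorem clock_not_linearTime {p B : Polynomial ℕ} (f : List Bool → List Bool)
    (hf : ∀ x r : List Bool, B.eval x.length ≤ r.length →
      f (boolPair x r) = ones (p.eval x.length) ++ false :: boolPair x r)
    (hgrow : ∀ κ : ℕ, ∃ n, κ * (B.eval n + n + 1) < p.eval n) :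
    ¬ ∃ a : ℕ, TimeComputable id id f fun n => a * n + a := by
  rintro ⟨a, M, hM⟩
  obtain ⟨n, hn⟩ := hgrow (3 * (machinePushBound M.tm * a))
  have hw := hM (boolPair (ones n) (ones (B.eval n)))
  have hlen := Turing.TM2ComputableAux.OutputsWithin.length_le hw
  rw [id, hf (ones n) (ones (B.eval n)) (by simp)] at hlen
  simp only [id, List.length_append, List.length_replicate, List.length_cons, length_boolPair]
    at hlen
  generalize machinePushBound M.tm = D at hlen hn
  generalize B.eval n = b at hlen hn
  have key : D * (a * (2 * n + 2 + b) + a) ≤ 3 * (D * a) * (b + n + 1) := by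
    rw [show D * (a * (2 * n + 2 + b) + a) = (D * a) * (2 * n + 3 + b) by ring]
    rw [show 3 * (D * a) * (b + n + 1) = (D * a) * (3 * b + 3 * n + 3) by ring]
    exact Nat.mul_le_mul_left _ (by omega)
  omega

/-- **No guard polynomial rescues the stub**: for EVERY `B`, `p = X (B + X + 1)` kills linear time;
the repair must RELATE `p` to `B` (`p ≤ B` pointwise — the line's only use site `B = budget p c' k`). -/
theorem stub_fuelledClock_false_of_guard
    (clockFn : Polynomial ℕ → Polynomial ℕ → List Bool → List Bool)
    (hclock : ∀ (p B : Polynomial ℕ) (x r : List Bool), B.eval x.length ≤ r.length →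
      clockFn p B (boolPair x r) = ones (p.eval x.length) ++ false :: boolPair x r)
    (B : Polynomial ℕ) :
    ¬ ∀ p : Polynomial ℕ, ∃ a : ℕ, TimeComputable id id (clockFn p B) fun n => a * n + a := by
  intro h
  refine clock_not_linearTime (p := X * (B + X + 1)) (B := B) (clockFn (X * (B + X + 1)) B)
    (hclock _ _) ?_ (h _)
  intro κ
  refine ⟨κ + 1, ?_⟩
  simp only [eval_mul, eval_add, eval_X, eval_one]
  nlinarith [Nat.zero_le (B.eval (κ + 1))]

end LineCoinPaddingSlices

section Targets
/-! ### Targets: line `universal-clock-padding` (PICKED 2026-08-17T11:39Z) — 4 stubs, 0 broken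

Cheap attacks run on `Lines/universal_clock_padding_Sketch.lean` (lead prover-line-stmt-QuantumAdvantage-15270-0):

* `stub_squareClock` (`∃ U₂ ∈ P`, complete when `h t ≤ |inst|²`, sound): the `|inst|²`-clocked twin of the
  tree's PROVED `ClockedUA.U` (`ClockedUniversalAcceptanceProofs.lean`, `pflat_complete`/`pflat_sound` at an
  arbitrary round count). Consistency of completeness ∧ soundness for one code `e`: both refer to the same
  deterministic `M` (`TM2Std.outputs_unique`), and `U₂`'s decider simulates `|inst|²` guarded micro-steps of
  the flat program `e` — uniform in `e`, polynomial in `|inst|`. Junk codes are rejected, so soundness is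
  not endangered by non-codes. No degenerate instance found (`M` with `K`/`Λ`/`σ` arbitrary finite types is
  handled by `ClockedUA.code`). RESISTS.
* `stub_instMap` (`W ↦ ⟨e, ⟨W, ε⟩⟩` linear time): output length `2 |W| + 2 |e| + 4`
  (`instMap_output_length`), so neither length bound bites; an FST composite. RESISTS.
* `stub_truncRun` (clock + `truncMapAux` + `M'`, time `A |x| + |z|` on pairs): quantified over pairs only
  (no totality trap); short `z` is fine (`z.take _ = z`, matching `outputsWithin_truncMapAux_boolPair`,
  which charges `|z| / 2`); the input-consumption floor `2|x| + 2 + |z| ≤ |out| + Q (A |x| + |z|)`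
  (`truncRun_consistent_with_reading`) is met for any `Q ≥ 1`. RESISTS.
* `stub_preimage` (`ρ⁻¹ U ∈ DTIME (n ^ max d 1)`): VACUOUS at `d = 0` (`DTIME_pow_zero_eq_empty`); at
  `d ≥ 1` it is `TimeComputable.comp_holds` with `s n = n + D (a n + a)` (`OutputsWithin.length_le`).
  RESISTS.

Joint sufficiency: `paddingCollapse → CompactnessPrinciple_of` is PROVED in the skeleton (no smuggled
gap); `paddingCollapse` is exactly `∃ c₀, BPP ⊆ bp (DTIME n^{c₀})`, which with `bp_DTIME_pow_eq_ite` must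
have `c₀ ≥ 1` (BPP ≠ ∅) — consistent with the skeleton's `max d₀ 1`. -/

open Literature.Computability.Complexity.TM2Comp (machinePopBound)

/-- Output length of the instance map of `stub_instMap`: linear in `|W|` with slope `2`. -/
theorem instMap_output_length (e W : List Bool) :
    (boolPair e (boolPair W [])).length = 2 * W.length + (2 * e.length + 4) := by
  simp only [length_boolPair, List.length_nil]; ring

/-- The reading floor any `Mhat` as in `stub_truncRun` must respect (input consumption): harmless,
since `Q = machinePopBound ≥ 1` for any machine that halts on a nonempty input — recorded to show the
`+ |z|` (coefficient `1`) of the stub's time bound is consistent with the halting rule. -/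
theorem truncRun_consistent_with_reading (Mhat : Turing.TM2ComputableAux Bool Bool) {x z out : List Bool}
    {T : ℕ} (h : Mhat.OutputsWithin (boolPair x z) out T) :
    2 * x.length + 2 + z.length ≤ out.length + machinePopBound Mhat.tm * T := by
  simpa using length_input_le_of_outputsWithin Mhat h

/-- `stub_preimage` at `d = 0` is vacuous: there is no `U ∈ DTIME (fun n => n ^ 0)`. -/
theorem stub_preimage_vacuous_at_zero (U : Language Bool) : U ∉ DTIME fun n => n ^ 0 := by
  rw [DTIME_pow_zero_eq_empty]; exact Set.notMem_empty U

end Targets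

section Intended
/-! ### The intended crux CP′ (restated forms) — irrefutability and the one negative avenue -/

open Literature.Computability.QuantumComplexity

/-- CP′ — the REPAIRED crux (cstrat r1 §6 / rattack Repair.lean): one classical exponent for
`BQTime(n²) = QuadQ` over the honest `BPTime`. -/
def CP' : Prop := BQP ⊆ BPP → ∃ c : ℕ, BQTime (fun n => n ^ 2) ⊆ BPTime (fun n => n ^ c)

/-- Ladder′ — the repaired sibling crux. -/
def Ladder' : Prop := ∀ c : ℕ, ∃ L ∈ BQTime (fun n => n ^ 2), L ∉ BPTime (fun n => n ^ c)

/-- `QuadQ` is literally `BQTime (· ^ 2)`. -/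
theorem quadQ_eq_BQTime : QuadQ = BQTime (fun n => n ^ 2) := rfl

/-- The summit implies CP′ (vacuous premise) — CP′ is a bridge, true in the `S`-world for free. -/
theorem summit_imp_cp' : _root_.QuantumAdvantage → CP' := by
  rintro ⟨L, hL, hLB⟩ hsub
  exact absurd (hsub hL) hLB

/-- **Irrefutability, typed form**: a refutation of the typed crux is a disproof of the summit. -/
theorem not_compactnessPrinciple_imp_not_summit : ¬ CompactnessPrinciple → ¬ _root_.QuantumAdvantage :=
  fun h hS => h (summit_imp_compactnessPrinciple hS)

/-- **Irrefutability, intended form (i)**: `¬ CP′` yields the collapse `BQP ⊆ BPP`. -/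
theorem not_cp'_imp_collapse : ¬ CP' → BQP ⊆ BPP := by
  intro h
  by_contra hno
  exact h fun hsub => absurd hsub hno

/-- **Irrefutability, intended form (ii)**: `¬ CP′` refutes the summit. So an unconditional Lean kill
of CP′ does not exist unless `QuantumAdvantage` is false; the disprover's negative avenue is relativised
(`OracleDichotomyPos`). -/
theorem not_cp'_imp_not_summit : ¬ CP' → ¬ _root_.QuantumAdvantage :=
  fun h hS => h (summit_imp_cp' hS)

/-- CP′ is exactly the glue `Ladder′ → S` of the repaired route (pure logic, as for the typed pair). -/
theorem cp'_iff_glue' : CP' ↔ (Ladder' → _root_.QuantumAdvantage) := by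
  constructor
  · intro hCP hLL
    by_contra hS
    have hsub : BQP ⊆ BPP := fun L hL => by
      by_contra hLB
      exact hS ⟨L, hL, hLB⟩
    obtain ⟨c, hc⟩ := hCP hsub
    obtain ⟨L, hL, hLc⟩ := hLL c
    exact hLc (hc hL)
  · intro hglue hsub
    by_contra hno
    have hLL : Ladder' := fun c => by
      by_contra h'
      exact hno ⟨c, fun L hL => by_contra fun hx => h' ⟨L, hL, hx⟩⟩
    obtain ⟨L, hL, hLB⟩ := hglue hLL
    exact hLB (hsub hL)

/-- **The one negative avenue: a relativised counterexample to CP′** (= the proposed signature of the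
informal item stmt-QuantumAdvantage-15277 `OracleDichotomy`, positive direction; crux idea
`levelled-trap-oracle`): an oracle language `A` with `BQP^A ⊆ BPP^A` and yet no uniform classical exponent
over `BQTime^A(n²)`. If constructible, CP′ has no relativising proof (it is then "non-relativising like
PlLift"); it does NOT refute CP′. Needs an oracle CONSTRUCTION (FFKL / Fortnow–Rogers generic base making
`BQP^A ⊆ BPP^A`, plus levelled Forrelation traps defeating each fixed exponent) — far beyond a cycle of
Lean; recorded as the standing target of the negative side. -/
def OracleDichotomyPos : Prop :=
  ∃ A : Language Bool, BQPRel A ⊆ BPPRel (Oracle.ofLanguage A) ∧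
    ∀ c : ℕ, ∃ L ∈ BQTimeRel A (fun n => n ^ 2), L ∉ BPTimeRel (Oracle.ofLanguage A) (fun n => n ^ c)

end Intended

end Summit.QuantumAdvantage.QuantumAdvantage.Cruxes.CompactnessPrinciple.Disproof
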